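import Mathlib
import Summits.MatrixMultiplication.MatrixMultiplication.Theses.SnSubsetDichotomy

/-!
# Sketch — crux `JuntaBranch` (stmt-MatrixMultiplication-8304), crux-ideate round 2, ideator 5

First lemmas of the idea card `Ideas/alignment-trichotomy.md`.

Conventions (tree): `TripleProductProperty S T U` is
`s * s'⁻¹ * (t * t'⁻¹) * (u * u'⁻¹) = 1 → s = s' ∧ t = t' ∧ u = u'` (right quotient sets
`Q(X) = X X⁻¹`); umvirate block `X_{I→L} = {σ ∈ X | ∀ k, σ (I k) = L k}`; MIXED quotient set
`A = S⁻¹T = {s⁻¹ t}` (the dense set of the route's deficit identity, item `QuotientSetDeficit`).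

* `block`, `mixed` — the two objects.
* `mixed_injOn` — unique representation in `S⁻¹T` under the TPP (`U ≠ ∅`).           PROVED
* `card_block_mixed` — the PROFILE-CONVOLUTION IDENTITY                                   PROVED
    `|(S⁻¹T)_{J→I}| = ∑_L |T_{J→L}| · |S_{I→L}|`
  (level-`t` profile matrices multiply: `P_{S⁻¹T} = P_T · P_Sᵀ`), the lever of the card: a bump of the
  mixed set at `(J → I)` is exactly a sum over COMMON TARGETS `L` of products of blocks of `T` and `S`,
  so it detects ALIGNMENT of bumps of the sparse sets and absorbs misaligned ones.
* `Aligned`, `AlignedOrAbsent` — the transfer target `C⁺` of the card (every `ε`-super-neutral block of a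
  member of a Large TPP triple is cashable AT ITS OWN TARGET), and
* `juntaBranch_of_alignedOrAbsent` — the reduction `UmvirateDescent → (∀ ε c, AlignedOrAbsent ε c) →
  JuntaBranch` (statement; it is the landed `stub_cash` p87211 composed with `UmvirateDescent` 8308).
-/

open Literature.Combinatorics.Additive

set_option linter.dupNamespace false

namespace Summit.MatrixMultiplication.MatrixMultiplication.Cruxes.JuntaBranch.SketchIdeator5

open Summit.MatrixMultiplication.MatrixMultiplication.Theses.SnSubsetDichotomy

/-- The umvirate block `X_{I→L} = {σ ∈ X | ∀ k, σ (I k) = L k}` (the route's inline notation). -/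
def block {n t : ℕ} (X : Finset (Equiv.Perm (Fin n))) (I L : Fin t → Fin n) :
    Finset (Equiv.Perm (Fin n)) :=
  X.filter (fun σ => ∀ k, σ (I k) = L k)

/-- The MIXED quotient set `S⁻¹T = {s⁻¹ t | s ∈ S, t ∈ T}` (route item `QuotientSetDeficit`). -/
def mixed {n : ℕ} (S T : Finset (Equiv.Perm (Fin n))) : Finset (Equiv.Perm (Fin n)) :=
  Finset.image₂ (fun s t => s⁻¹ * t) S T

/-- Unique representation in `S⁻¹T` under the TPP with `U ≠ ∅` (the pairwise part of the TPP):
`(s, t) ↦ s⁻¹ t` is injective on `S × T`. [folklore; CohnUmans2003 Lemma 3.1] -/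
theorem mixed_injOn {n : ℕ} {S T U : Finset (Equiv.Perm (Fin n))}
    (hTPP : TripleProductProperty S T U) (hU : U.Nonempty) :
    Set.InjOn (Function.uncurry fun (s t : Equiv.Perm (Fin n)) => s⁻¹ * t)
      ((S ×ˢ T : Finset _) : Set (Equiv.Perm (Fin n) × Equiv.Perm (Fin n))) := by
  obtain ⟨u, hu⟩ := hU
  rintro ⟨s, t⟩ hst ⟨s', t'⟩ hst' h
  simp only [Finset.coe_product, Set.mem_prod, Finset.mem_coe] at hst hst'
  simp only [Function.uncurry_apply_pair] at h
  -- `s⁻¹ t = s'⁻¹ t'` gives the triple-product relation `s' s⁻¹ (t t'⁻¹) (u u⁻¹) = 1`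
  have key : s' * s⁻¹ * (t * t'⁻¹) * (u * u⁻¹) = 1 := by
    have h1 : s' * (s⁻¹ * t) * t'⁻¹ = s' * (s'⁻¹ * t') * t'⁻¹ := by rw [h]
    have h2 : s' * (s'⁻¹ * t') * t'⁻¹ = 1 := by group
    calc s' * s⁻¹ * (t * t'⁻¹) * (u * u⁻¹) = s' * (s⁻¹ * t) * t'⁻¹ := by group
      _ = 1 := by rw [h1, h2]
  obtain ⟨hs, ht, -⟩ := hTPP s' hst'.1 s hst.1 t hst.2 t' hst'.2 u hu u hu key
  exact Prod.ext hs.symm ht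

/-- **PROFILE-CONVOLUTION IDENTITY** (the card's lever).  For a TPP triple `(S, T, U)` with `U ≠ ∅`
and any source/target tuples `J, I : Fin t → Fin n`, the block of the mixed set `S⁻¹T` at `(J → I)`
decomposes over common targets:
`|(S⁻¹T)_{J→I}| = ∑_{L : Fin t → Fin n} |T_{J→L}| · |S_{I→L}|`
(an element `s⁻¹t` maps `J ↦ I` iff `t ∘ J = s ∘ I =: L`; unique representation makes the count exact;
non-injective `L` contribute `0` automatically when `I` or `J` is injective).  In ratio form
`R_{S⁻¹T}(J→I) = (1/n^{(t)}) ∑_L R_T(J→L) R_S(I→L)`: the level-`t` profile of the dense mixed set is the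
product of the profiles of the two sparse sets, so (i) `R_{S⁻¹T}(J→I) ≥ R_T(J→L)R_S(I→L)/n^{(t)}` for every
`L` — ALIGNED bumps of `S, T` at a common target are visible as a bump of `S⁻¹T`; (ii) conversely a bump
`R_{S⁻¹T}(J→I) ≥ K` forces a common target `L` with `R_T(J→L) R_S(I→L) ≥ K` (an average over `L` with
weights `R_T(J→L)/n^{(t)}`); (iii) a bump of `S` at `(I→L₀)`, isolated in its row, facing partners
uniformly `θ`-sub-neutral at `L₀` (MISALIGNED) leaves `S⁻¹T` flat on target `I`
(`R_{S⁻¹T}(J→I) ≤ θ + max_{L ≠ L₀} R_S(I→L)` for every `J`) and likewise `U⁻¹S` on source `I` — the bump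
is invisible to the deficit identity `#{abc = 1} = |S||T||U|` on the mixed sets. [this card] -/
theorem card_block_mixed {n t : ℕ} {S T U : Finset (Equiv.Perm (Fin n))}
    (hTPP : TripleProductProperty S T U) (hU : U.Nonempty) (I J : Fin t → Fin n) :
    (block (mixed S T) J I).card =
      ∑ L : Fin t → Fin n, (block T J L).card * (block S I L).card := by
  classical
  -- Step 1: pull the block back to `S × T` along the injective map `(s,t) ↦ s⁻¹ t`.
  have hinj := mixed_injOn hTPP hU
  set F : Equiv.Perm (Fin n) × Equiv.Perm (Fin n) → Equiv.Perm (Fin n) :=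
    Function.uncurry fun s t => s⁻¹ * t with hF
  have hmixed : mixed S T = (S ×ˢ T).image F := rfl
  set P : Finset (Equiv.Perm (Fin n) × Equiv.Perm (Fin n)) :=
    (S ×ˢ T).filter (fun st => ∀ k, st.2 (J k) = st.1 (I k)) with hP
  have hblock : block (mixed S T) J I = P.image F := by
    rw [block, hmixed, Finset.filter_image]
    congr 1
    refine Finset.filter_congr ?_
    rintro ⟨s, t⟩ -
    simp only [hF, Function.uncurry_apply_pair, Equiv.Perm.mul_apply]
    refine forall_congr' fun k => ?_
    rw [Equiv.Perm.inv_eq_iff_eq]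
  have hPsub : P ⊆ S ×ˢ T := Finset.filter_subset _ _
  have hcard : (block (mixed S T) J I).card = P.card := by
    rw [hblock]
    exact Finset.card_image_of_injOn (hinj.mono (Finset.coe_subset.2 hPsub))
  rw [hcard]
  -- Step 2: fibre over the common target `L := s ∘ I`.
  have hmaps : (P : Set _).MapsTo (fun st : Equiv.Perm (Fin n) × Equiv.Perm (Fin n) =>
      fun k => st.1 (I k)) (Finset.univ : Finset (Fin t → Fin n)) :=
    fun _ _ => Finset.mem_coe.2 (Finset.mem_univ _)
  rw [Finset.card_eq_sum_card_fiberwise hmaps]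
  refine Finset.sum_congr rfl fun L _ => ?_
  -- Step 3: the fibre over `L` is `S_{I→L} × T_{J→L}`.
  have hfib : (P.filter fun st => (fun k => st.1 (I k)) = L) =
      (block S I L) ×ˢ (block T J L) := by
    rw [hP, Finset.filter_filter, block, block, ← Finset.filter_product]
    refine Finset.filter_congr ?_
    rintro ⟨s, t⟩ -
    simp only [funext_iff]
    constructor
    · rintro ⟨h1, h2⟩
      exact ⟨h2, fun k => by rw [h1 k, h2 k]⟩
    · rintro ⟨h2, h3⟩
      exact ⟨fun k => by rw [h3 k, h2 k], h2⟩
  rw [hfib, Finset.card_product, Nat.mul_comm]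

/-- `ALIGNED ε c n S T U`: every `ε`-super-neutral block `(I→L)` (level `1 ≤ t ≤ √n`) of a member `X` of
the triple is CASHABLE AT ITS OWN TARGET: there are partner source blocks `J, P` with
`R_X(I→L)·R_Y(J→L)·R_Z(P→L) ≥ e^{c+1} (n^{(t)})^{3/2}`, written multiplied out
(`R_W(K→L) = |W_{K→L}|·n^{(t)}/|W|`):
`e^{c+1} (n^{(t)})^{3/2} |X||Y||Z| ≤ |X_{I→L}||Y_{J→L}||Z_{P→L}| (n^{(t)})³`. -/
def Aligned (ε c : ℝ) (n : ℕ) (S T U : Finset (Equiv.Perm (Fin n))) : Prop :=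
  ∀ X Y Z : Finset (Equiv.Perm (Fin n)),
    ((X = S ∧ Y = T ∧ Z = U) ∨ (X = T ∧ Y = U ∧ Z = S) ∨ (X = U ∧ Y = S ∧ Z = T)) →
    ∀ t : ℕ, 1 ≤ t → (t : ℝ) ≤ Real.sqrt (n : ℝ) → ∀ I L : Fin t → Fin n,
      Function.Injective I → Function.Injective L →
      (n : ℝ) ^ ((1 / 2 + ε) * t) * (X.card : ℝ) < ((block X I L).card : ℝ) * (n.descFactorial t : ℝ) →
      ∃ J P : Fin t → Fin n, Function.Injective J ∧ Function.Injective P ∧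
        Real.exp (c + 1) * (n.descFactorial t : ℝ) ^ ((3 : ℝ) / 2) *
            ((X.card * Y.card * Z.card : ℕ) : ℝ) ≤
          (((block X I L).card * (block Y J L).card * (block Z P L).card : ℕ) : ℝ) *
            (n.descFactorial t : ℝ) ^ (3 : ℕ)

/-- **TRANSFER TARGET `C⁺` (card alignment-trichotomy): ALIGNED-OR-ABSENT.**  Eventually, in every
Large(`c`) TPP triple of `S_n`, every `ε`-super-neutral umvirate block of every member is aligned
(cashable at its own target).  Equivalently: MISALIGNED bumps — a super-neutral block of one set facing
partners whose best atoms at that target multiply to `< e^{c+1}(n^{(t)})^{3/2}/R_X` — DO NOT OCCUR near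
the threshold.  By the same-target packing cap (triage T1/B1) no block of level `t ≥ (2c√n)/(ε ln n)`
can be aligned, so `C⁺` contains HIGH-LEVEL BUMP EXCLUSION; by slicing (`exists_heavy_atom`) it contains
"no level-1-flat Large triples"; it is strictly STRONGER than the crux and implies it through the landed
cash step. -/
def AlignedOrAbsent (ε c : ℝ) : Prop :=
  ∃ n₀ : ℕ, ∀ n ≥ n₀, ∀ S T U : Finset (Equiv.Perm (Fin n)), TripleProductProperty S T U →
    (n.factorial : ℝ) ^ ((3 : ℝ) / 2) * Real.exp (-(c * Real.sqrt (n : ℝ))) ≤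
        ((S.card * T.card * U.card : ℕ) : ℝ) →
    Aligned ε c n S T U

/-- **REDUCTION** (statement; provable now: it is `stub_cash` (p87211, landed) — rotate the bumped set
to the front by cyclic invariance of the TPP, cash the aligned block with `UmvirateDescent` at
`n' = n - t ∈ [n - √n, n)`, and `(n^{(t)})^{3/2}·((n-t)!/n!)^{3/2} = 1`). -/
def juntaBranch_of_alignedOrAbsent : Prop :=
  UmvirateDescent → (∀ ε : ℝ, 0 < ε → ∀ c : ℝ, 0 < c → AlignedOrAbsent ε c) → JuntaBranch

end Summit.MatrixMultiplication.MatrixMultiplication.Cruxes.JuntaBranch.SketchIdeator5
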